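import Summits.QuantumFields.BalabanUV.Beta.GAN24.FieldResponseCoarseGradient
import Summits.QuantumFields.BalabanUV.Beta.GAN24.BornLambdaTent

/-!
# `BalabanUV.Beta.GAN24.TowerClassClosure` — binder row G-an2-4 ∕ (CONV-C), the (S) row ∕ (W-γ) one level up, the β-CHAIN (levels ≥ 2), FILE F2b:
# **THE TOWER CLASS IS CLOSED UNDER ONE LEVEL OF DEPTH — `P`-periodic data have `Lc·P`-periodic field responses, the `P`-cube label composed with `blk` is the `Lc·P`-cube
# label, and a slot datum whose multiplier response is a `P`-coarse gradient has a field response whose multiplier response one level down is an `Lc·P`-coarse gradient: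
# `C_{j+1} h = 𝒬ᵀ_P β ⇒ C_j(H_{j+1} h) = 𝒬ᵀ_{Lc·P}((stepScale_{j+1}∕wVH_{j+1})·β)`** (centred root, every `j`, every `P ≥ 1`)
# (G-an2-4 CRUX TEAM (2), seat `b2b-balaban-gan24-formalise-leaf-06` = the (γ) hand, gen 50, file F2b of the successor plan in `LEVELS-GE2.md`)

NOT IN PRINT; OUR BOOKKEEPING ([folklore] BY NAME: TODAY's `FieldResponseCoarseGradient.multResponse_fieldResponse_eq` (the β-link), an4's `OneStepKernelFamily.colH_translate` with
an2's `shiftK_coDressKBmAt_KInvStep` (block covariance), `KKTFluctuationEnergy.contourSumAdj_eq`, an3's `BornLambdaTent.contourSumAdj_const_mul`, `Int.ediv_ediv_of_nonneg`; 0 `def`, 0 cited fact, 0 `def … : Prop`, 0 sorry).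
HONEST FRAMING (cell contract, verbatim): «discharging `BetaPertH` makes Bałaban's UV stability UNCONDITIONAL — a real constructive-QFT result; it is NOT the continuum limit and NOT
the Clay problem.»  HONEST DEPENDENCY (verbatim): «continuum YM on T⁴ ⇐ BetaPertH ∧ nine spine estimates (0/9 proved); BetaPertH ⇐ (D1) ∧ (D4) ∧ CAP+tail; G-an2-4 gates asym,
D1 and NE2/3/4.»

WHY (memo `HOME/b2b-balaban-gan24-formalise-leaf-06/g50/LEVELS-GE2.md`, journal PROPOSED-3 + A-7).  The level induction `SourcePairingTowerClosed` (next) is stated for the CLASS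
«`h` summable and bounded with `C_j h = 𝒬ᵀ_P β` (`β κ` summable), `n` bounded `P`-periodic, `φ = 𝟙[blk P · = y]`»; the cubic sector (`CubicSectorLevelDown.cubicSector_SrecAt_eq_levelDown`)
evaluates the level below at `(H_{j+1} h, H_{j+1} n, φ ∘ blk)`, and THIS FILE shows that triple is in the class with `P ↦ Lc·P` and `β ↦ (stepScale_{j+1}∕wVH_{j+1})·β`.
* §1 lattice arithmetic: `blk_blk` (`blk P (blk L x) = blk (L·P) x`), `sum_range_mul` (`Σ_{r<a·b} f r = Σ_{s′<b} Σ_{s<a} f (s + a·s′)`), `quo_quo_sub` and **`contourSumAdj_contourSumAdj`**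
  (`𝒬ᵀ_{Lc}(𝒬ᵀ_P β) = 𝒬ᵀ_{Lc·P} β`) (the scalar rule is an3's `BornLambdaTent.contourSumAdj_const_mul`).
* §2 `fieldResponse_periodic` (`H_j n` is `Lc·P`-periodic for `P`-periodic `n`).
* §3 **`multResponse_fieldResponse_eq_contourSumAdj_mul`** — the statement in the title.
Asserts NO value of any resolvent column beyond (T1)'s Euler–Lagrange identity (through the β-link); NOTHING of `hX` at `j ≥ 1` ∕ (W-γ)_{≥2} ∕ (INV) ∕ (S) above level 1 discharged;
NEVER «G-an2-4 closed» as (CONV-C); NOT D1, NOT `BetaPertH`, NOT continuum, NOT Clay.  2026-08-23; no existing file touched.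
-/

noncomputable section

open Finset
open scoped BigOperators
open Literature.MathematicalPhysics.QuantumFieldTheory
open Literature.MathematicalPhysics.QuantumFieldTheory.Balaban1983to89
open Literature.MathematicalPhysics.QuantumFieldTheory.Balaban1983to89.Beta
open ExpKernelCalculus (Site MKer Decays)
open LatticeForm (quo)
open AffineAveraging (Form1 box toSite unitVec unitVec_apply)
open AffineReproduction (contourSumAdj)
open KKTFluctuationEnergy (contourSumAdj_eq)
open AveragingContours (blk)
open AveragingContoursRooted (ctrOff ctrOff_mem_box)
open OneStepKernelFamily (KInvStep colH colH_translate)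
open SecondOrderResponse (colM)
open BalabanStepJetsSucc (wVH)
open Summit.QuantumFields.BalabanUV.Beta.AxialDressingRooted (coDressKBmAt one_le_of_neZero shiftK_coDressKBmAt_KInvStep)
open Summit.QuantumFields.BalabanUV.Beta.BorderedHessian (stepScale)
open Summit.QuantumFields.BalabanUV.Beta.GAN24.FieldResponseCoarseGradient (multResponse_fieldResponse_eq)

namespace Summit.QuantumFields.BalabanUV.Beta.GAN24.TowerClassClosure

variable {d : ℕ}

/-! ## §1 Lattice arithmetic: nested block labels and nested adjoint contour sums -/

/-- [folklore] **NESTED BLOCK LABELS**: `blk P (blk L x) = blk (L·P) x` (`⌊⌊x∕L⌋∕P⌋ = ⌊x∕(L·P)⌋` coordinatewise, `Int.ediv_ediv_of_nonneg`). -/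
theorem blk_blk (L P : ℕ) (x : Site (d + 1)) : blk P (blk L x) = blk (L * P) x := by
  funext i
  simp only [AveragingContours.blk]
  push_cast
  exact Int.ediv_ediv_of_nonneg (Int.natCast_nonneg L)

/-- [folklore] `Σ_{r < a·b} f r = Σ_{s′ < b} Σ_{s < a} f (s + a·s′)` (`Finset.sum_range_add`, induction on `b`). -/
theorem sum_range_mul (f : ℕ → ℝ) (a : ℕ) : ∀ b : ℕ, ∑ r ∈ Finset.range (a * b), f r = ∑ s' ∈ Finset.range b, ∑ s ∈ Finset.range a, f (s + a * s')
  | 0 => by simp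
  | b + 1 => by
    rw [Nat.mul_succ, Finset.sum_range_add, sum_range_mul f a b, Finset.sum_range_succ]
    congr 1
    exact Finset.sum_congr rfl fun s _ => by rw [add_comm (a * b) s]

/-- [folklore] **NESTED QUOTIENTS ALONG A CONTOUR**: `quo_P(quo_{L}(x − s•e_κ) − s′•e_κ) = quo_{L·P}(x − (s + L·s′)•e_κ)` (`1 ≤ L`). -/
theorem quo_quo_sub {L : ℕ} (hL : 1 ≤ L) (P : ℕ) (x : Site (d + 1)) (κ : Fin (d + 1)) (s s' : ℕ) :
    quo P (quo L (x - (s : ℤ) • unitVec κ) - (s' : ℤ) • unitVec κ) = quo (L * P) (x - ((s + L * s' : ℕ) : ℤ) • unitVec κ) := by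
  have hL0 : (L : ℤ) ≠ 0 := by exact_mod_cast (show L ≠ 0 by omega)
  funext i
  simp only [LatticeForm.quo, Pi.sub_apply, Pi.smul_apply, unitVec_apply, smul_eq_mul]
  push_cast
  by_cases hi : i = κ
  · simp only [if_pos hi, mul_one]
    have e1 : (x i - (s : ℤ)) / (L : ℤ) - (s' : ℤ) = (x i - ((s : ℤ) + (L : ℤ) * (s' : ℤ))) / (L : ℤ) := by
      rw [show x i - ((s : ℤ) + (L : ℤ) * (s' : ℤ)) = (x i - (s : ℤ)) + (L : ℤ) * (-(s' : ℤ)) by ring, Int.add_mul_ediv_left _ _ hL0]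
      ring
    rw [e1, Int.ediv_ediv_of_nonneg (Int.natCast_nonneg L)]
  · simp only [if_neg hi, mul_zero, sub_zero]
    exact Int.ediv_ediv_of_nonneg (Int.natCast_nonneg L)

/-- NOT IN PRINT; OUR BOOKKEEPING.  **NESTED ADJOINT CONTOUR SUMS**: `𝒬ᵀ_{L}(𝒬ᵀ_P β) κ x = 𝒬ᵀ_{L·P} β κ x` (`1 ≤ L`, every `P`, every coarse 1-form `β`): the `L` positions of the outer
contour times the `P` positions of the inner one are the `L·P` positions of the long contour (`quo_quo_sub`, `sum_range_mul`). -/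
theorem contourSumAdj_contourSumAdj {L : ℕ} (hL : 1 ≤ L) (P : ℕ) (β : Form1 (d + 1) ℝ) (κ : Fin (d + 1)) (x : Site (d + 1)) :
    contourSumAdj L (contourSumAdj P β) κ x = contourSumAdj (L * P) β κ x := by
  simp only [contourSumAdj_eq]
  rw [sum_range_mul (fun r => β κ (quo (L * P) (x - (r : ℤ) • unitVec κ))) L P, Finset.sum_comm]
  refine Finset.sum_congr rfl fun s _ => Finset.sum_congr rfl fun s' _ => ?_
  exact congrArg (β κ) (quo_quo_sub hL P x κ _ _)

/-- [folklore] The `P`-cube label composed with the block map is the `Lc·P`-cube label: `𝟙[blk P (blk Lc x) = y] = 𝟙[blk (Lc·P) x = y]` as functions. -/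
theorem cubeLabel_comp_blk (Lc P : ℕ) (y : Site (d + 1)) :
    (fun x : Site (d + 1) => if blk P (blk Lc x) = y then (1 : ℝ) else 0) = fun x => if blk (Lc * P) x = y then (1 : ℝ) else 0 := by
  funext x; rw [blk_blk]

/-! ## §2 Field responses of periodic data are periodic one scale up -/

variable {Lc : ℕ} [NeZero Lc]

/-- NOT IN PRINT; OUR BOOKKEEPING.  **THE FIELD RESPONSE OF `P`-PERIODIC DATA IS `Lc·P`-PERIODIC** (in-block root `ρ`, every `j`, every `P`; no summability needed — a reindexing):
`(H_j n) κ (u + (Lc·P)•z) = (H_j n) κ u` for `n l (t + P•z) = n l t`, `(H_j n) κ u = Σ_l Σ'_t n l t·colH G_j Lc l t κ u` (block covariance `colH_translate` moves the field translation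
`Lc•(P•z)` onto the datum as `−P•z`, and the datum series is reindexed). -/
theorem fieldResponse_periodic (ρ : Site (d + 1)) (j : ℕ) {n : Form1 (d + 1) ℝ} {P : ℕ}
    (hper : ∀ (l : Fin (d + 1)) (t z : Site (d + 1)), n l (t + (P : ℤ) • z) = n l t) (κ : Fin (d + 1)) (u z : Site (d + 1)) :
    (∑ l, ∑' t : Site (d + 1), n l t * colH (coDressKBmAt ρ Lc (KInvStep (d := d) Lc j)) Lc l t κ (u + ((Lc * P : ℕ) : ℤ) • z))
      = ∑ l, ∑' t : Site (d + 1), n l t * colH (coDressKBmAt ρ Lc (KInvStep (d := d) Lc j)) Lc l t κ u := by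
  refine Finset.sum_congr rfl fun l _ => ?_
  set G := coDressKBmAt ρ Lc (KInvStep (d := d) Lc j) with hGdef
  -- move the field translation onto the datum
  have htr : ∀ t : Site (d + 1), colH G Lc l t κ (u + ((Lc * P : ℕ) : ℤ) • z) = colH G Lc l (t - (P : ℤ) • z) κ u := by
    intro t
    have h := colH_translate (shiftK_coDressKBmAt_KInvStep (Lc := Lc) ρ j) l (t - (P : ℤ) • z) ((P : ℤ) • z) κ (u + ((Lc * P : ℕ) : ℤ) • z)
    rw [sub_add_cancel] at h
    rw [hGdef, h]
    congr 1
    rw [smul_smul]; push_cast; abel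
  simp only [htr]
  -- reindex the datum series `t ↦ t + P•z`
  rw [← (Equiv.addRight ((P : ℤ) • z)).tsum_eq (fun t => n l t * colH G Lc l (t - (P : ℤ) • z) κ u)]
  refine tsum_congr fun t => ?_
  simp only [Equiv.coe_addRight, add_sub_cancel_right, hper l t z]

/-! ## §3 The slot factor one level down is a coarse gradient one scale up -/

/-- NOT IN PRINT; OUR BOOKKEEPING.  **`C_{j+1} h = 𝒬ᵀ_P β ⇒ C_j(H_{j+1} h) = 𝒬ᵀ_{Lc·P}((stepScale_{j+1}∕wVH_{j+1})·β)`** (centred root, every `j`, every `P`, `h` bounded; `G_k = coDressKBmAt ρ_c Lc (KInvStep Lc k)`,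
`(C_k m)(κ,u) = Σ_a Σ'_v m a v·colM G_k Lc a v κ u`, `(H_{j+1} h)(a,v) = Σ_μ Σ'_y h μ y·colH G_{j+1} Lc μ y a v`): the β-link `FieldResponseCoarseGradient.multResponse_fieldResponse_eq`
and the nesting `contourSumAdj_contourSumAdj`. -/
theorem multResponse_fieldResponse_eq_contourSumAdj_mul (j : ℕ) {h : Form1 (d + 1) ℝ} {Bh : ℝ} (hh : ∀ μ y, |h μ y| ≤ Bh) {P : ℕ} {β : Form1 (d + 1) ℝ}
    (hCh : ∀ (ρ' : Fin (d + 1)) (w : Site (d + 1)),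
      (∑ μ, ∑' y : Site (d + 1), h μ y * colM (coDressKBmAt (toSite (ctrOff (d + 1) Lc)) Lc (KInvStep (d := d) Lc (j + 1))) Lc μ y ρ' w) = contourSumAdj P β ρ' w)
    (κ : Fin (d + 1)) (u : Site (d + 1)) :
    (∑ a : Fin (d + 1), ∑' v : Site (d + 1),
        (∑ μ, ∑' y : Site (d + 1), h μ y * colH (coDressKBmAt (toSite (ctrOff (d + 1) Lc)) Lc (KInvStep (d := d) Lc (j + 1))) Lc μ y a v)
          * colM (coDressKBmAt (toSite (ctrOff (d + 1) Lc)) Lc (KInvStep (d := d) Lc j)) Lc a v κ u)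
      = contourSumAdj (Lc * P) (fun μ w => (stepScale d Lc (j + 1) / wVH d Lc (j + 1)) * β μ w) κ u := by
  have hLc1 : 1 ≤ Lc := one_le_of_neZero Lc
  have hwVH : wVH d Lc (j + 1) ≠ 0 := by
    unfold BalabanStepJetsSucc.wVH; exact pow_ne_zero _ (pow_ne_zero _ (by exact_mod_cast NeZero.ne Lc))
  have hlink := multResponse_fieldResponse_eq (d := d) (Lc := Lc) j hh κ u
  have hfun : (fun ρ' w => ∑ μ, ∑' y : Site (d + 1), h μ y * colM (coDressKBmAt (toSite (ctrOff (d + 1) Lc)) Lc (KInvStep (d := d) Lc (j + 1))) Lc μ y ρ' w)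
      = contourSumAdj P β := by
    funext ρ' w; exact hCh ρ' w
  rw [hfun, contourSumAdj_contourSumAdj hLc1 P β κ u] at hlink
  rw [BornLambdaTent.contourSumAdj_const_mul, div_mul_eq_mul_div, eq_div_iff hwVH, mul_comm _ (wVH d Lc (j + 1)), hlink]

end Summit.QuantumFields.BalabanUV.Beta.GAN24.TowerClassClosure

end
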